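import Mathlib
import Summits.Schanuel.Schanuel.Theses.RigidCore
import Literature.NumberTheory.Transcendental.KirbyEDerivations
import Literature.NumberTheory.Transcendental.KirbyWeakSchanuelAx
import Literature.NumberTheory.Transcendental.SchanuelEclEmptyProofs
import Literature.NumberTheory.Transcendental.EclClosureOperatorProofs
import Literature.Barriers.Schanuel.AxSchanuelFunctionalNotNumerical
import Summits.Schanuel.Schanuel.Theorems.RigidCoreSchanuelOnLogFreeCoreRootGerm
import Summits.Schanuel.Schanuel.Theorems.RigidCoreSchanuelOnLogFreeCoreImplicitDeriv
import Summits.Schanuel.Schanuel.Theorems.RigidCoreSchanuelOnLogFreeCoreTermGerm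
import Summits.Schanuel.Schanuel.Theorems.RigidCoreSchanuelOnLogFreeCoreGenericFibre
import Summits.Schanuel.Schanuel.Theorems.RigidCoreSchanuelOnLogFreeCoreCalibrationA
import Summits.Schanuel.Schanuel.Theorems.RigidCoreSchanuelOnLogFreeCoreCalibrationB

/-!
# Line `generic-period-fibre` — skeleton for crux `RigidCore.SchanuelOnLogFreeCore` (R)
# (stmt-Schanuel-0970, route-Schanuel-RigidCore; crux-plan of idea `generic-period-fibre`, triage r1: 3 × pass)

**Idea.** The log-free core `C_EA = sInf {K ≤ ℂ | 2πi ∈ K, K exp-closed, K relatively algebraically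
closed}` of the crux is the KERNEL FIBRE `F_{2πi}` of the one-parameter family of EA-closures
`F_ω := sInf {K | ω ∈ K, K exp-closed, K r.a.c.}` (`fibre ω`; `logFreeCore = fibre (2πi)` by `rfl`),
all of which contain the KERNEL-FREE CORE `M := sInf {K | K exp-closed, K r.a.c.}` (`kernelFreeCore`,
Macintyre's sector `ℚ^{EA} ∩ ℂ`). Two moves.

1. HORIZONTAL SPLIT (exact, kernel-checked here): Schanuel on `C_EA` ⟸ Schanuel on `M` (stub A)
   ∧ relative Schanuel of `C_EA` over `M` (stub B, "the period is generic over the kernel-free core":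
   the shape of the PROVED tree fact `kirby_relative_schanuel_complex` with `ℚ(ecl ∅) ↦ M`, `ℂ ↦ C_EA`).
   `horizontalSplit` proves this for ANY exp-closed base `M` and any `L` (adapted basis of
   `span x = (span x ∩ M) ⊕ U`, clearing denominators, base change `trdeg_adjoin_le_of_le`, tower
   `add_le_trdeg_adjoin_union` — the architecture of the tree's `schanuelConjecture_iff_ecl_empty_of_kirby`
   with `ecl ∅ ↦ M`), and `SchanuelOnLogFreeCore_of` specialises it: the crux BY NAME, no hypotheses,
   `sorry` only inside the stubs.
2. GENERIC FIBRE (the lever; a theorem modulo ONE analytic stub): for `ω ∉ dcl ∅` (Kirby's derivation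
   closure, tree `Literature.NumberTheory.Transcendental.dcl`; `= ecl ∅` by Kirby 2010 Thm 1.1) the SAME
   relative statement `RelSchanuel (fibre ω) kernelFreeCore` HOLDS (`genericFibre`), and Schanuel on
   `F_ω` reduces to Schanuel on `M` (`schanuelOn_fibre_of_generic`). Proof, sorry-free here from stub C:
   NO HIDDEN CONSTANTS `F_ω ∩ dcl ∅ ⊆ M` (`noHiddenConstants_of_termGerm`: an E-derivation `D` with
   `D ω ≠ 0`, the E-chain rule `D (f ω) = f′(ω) · D ω` along log-free term germs and Taylor's theorem
   force a `dcl ∅`-valued germ to be constant, hence equal to its value at an algebraic point, which lies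
   in `F_α = M`), then Kirby's relative Schanuel theorem over `ecl ∅` (tree, PROVED:
   `kirby_relative_schanuel_complex_holds`) and base change down to `M ≤ ℚ(ecl ∅)`
   (`genericFibre_of_noHiddenConstants`). Stub C (`stub_termGerm`) is the term-germ representation of
   fibre elements — TRUE FOR EVERY `ω` (genericity enters only through `D ω ≠ 0` in the glue).

**Why the kernel fibre is left over** (barrier `Literature.Barriers.Schanuel.AxSchanuelFunctionalNotNumerical`,
USED not evaded; disprover's `eDerivation_apply_eq_zero_of_mem_core`): `2πi ∈ dcl ∅`
(`two_pi_I_mem_dcl_empty`: `e^{2πi} = 1` kills every E-derivation on the period), so `genericFibre`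
is silent at `ω = 2πi`; its kernel-fibre instance is exactly stub B, the crux's arithmetic residue, and
stub A is the fibre-independent part. `A ∧ B ⟺ (R)` in substance ((R) ⇒ A by `M ≤ C_EA`; (R) ⇒ B by
the predimension/hull count), so the split is a CALIBRATION, not an engine: both A and B contain
`e ⊥ π`-strength instances (A ⇒ `π ∉ M` ⇒ `e ⊥ π`, `π ⊥ e^e`; B at rank 2 ∋ "`π, e^{−4π²}`
algebraically independent over `M`"), as all three triagers record. Stub B at rank 1 is bookkeeping
(`relSchanuel_rank_one`, proved).

**STATUS (line lead, end of cycle 1, 2026-08-16).** LANDED under `Theorems/` (all `--supports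
stmt-Schanuel-0970`, axioms propext/Classical.choice/Quot.sound): C1 `stub_rootGerm` (p71340,
`RigidCoreSchanuelOnLogFreeCoreRootGerm.lean`), C2 `stub_implicitDeriv` (p71467,
`…ImplicitDeriv.lean`), the objects `eaFibre`/`kernelFreeCore`/`IsLogFreeTerm` + stub D
`stub_eaFibre_le_kernelFreeCore` (p73836, `RigidCoreDefs.lean`), C `stub_termGerm` (p73975,
`…TermGerm.lean`), and the line's two deliverable theorems NHC `stub_noHiddenConstants` / GF
`stub_genericFibre` (p74640, `…GenericFibre.lean`) — below they are DISCHARGED by the landed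
declarations. The ONLY remaining `sorry`s are stubs A and B, the crux's arithmetic residue (both
open sub-conjectures of SC ⊇ `e ⊥ π`; kernel-checked calibration certificates attached as item
evidence: A ⟹ ExpOnePiAlgebraicIndependent, A ⟹ π ∉ M; SC ⟹ B; B ∧ π ∉ M ⟹ e^{π²} transcendental;
B vacuous iff π ∈ M).

**STATUS (line lead -1, cycle 1, 2026-08-16).** The five landing/calibration stubs NHC, GF, calibA, calibB₁,
calibB₂ are now DISCHARGED BY NAME from their landed `Theorems/` files (imports above); the skeleton's `sorry`s are
A, B (the crux's residue, open) and the five new landing stubs S1 `stub_splitExact` ((R) ⟺ A ∧ B), S1a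
`stub_horizontalSplit` (general split, ticket for the proved glue), S2 `stub_calibR_piLogTwo` ((R) ⟹ π ⊥ log 2),
S3 `stub_calibA_noPi` (A ⟹ π ∉ M), S3a `stub_kernelFreeCore_exhaust` (EA-construction sequences exhaust `M`),
each to be replaced by its landed name this cycle.

**Shape.** One theorem (`SchanuelOnLogFreeCore_of`) concludes
`Summit.Schanuel.Schanuel.Theses.RigidCore.SchanuelOnLogFreeCore` BY NAME with no hypotheses; `sorry`
occurs only in `stub_schanuelOnKernelFreeCore`, `stub_periodGenericOverCore`, `stub_termGerm` and (lead's
reshape, cycle 1) the two Mathlib-only analytic sub-stubs `stub_rootGerm`, `stub_implicitDeriv` of C; every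
stub is stated over EXISTING declarations only (the `sInf` set-builders are inlined verbatim — the one
for `C_EA` is the crux decl's), so a `Theorems/` file can prove each verbatim; the glue vocabulary
(`kernelFreeCore`, `fibre`, `logFreeCore`, `SchanuelOn`, `RelSchanuel`, `IsEA`) is local and
definitionally equal to the inlined forms. Glue axioms: propext, Classical.choice, Quot.sound (+ sorryAx
from the stubs it invokes).

**Disproof used** (cdisprove `Disproof.lean` on stmt-Schanuel-0970, cycles 1/1b of 2026-08-15, read
through its evidence notes — the file is not mounted in this seat and no `Negative/` lemma has landed, so
nothing is imported): `¬WithoutLinIndep*` — `LinearIndependent ℚ x` is consumed in `horizontalSplit`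
(`finrank_span_eq_card hx`) and re-emerges as the `mkQ`-independence hypothesis of stub B (multiples of
`2πi` and `M`-translates are excluded exactly there); refuted strengthenings (`n+1 ≤ trdeg`, `2n ≤ trdeg`,
`n ≤ trdeg ℚ(eˣ)`, `n ≤ trdeg ℚ(x)`, `AlgIndep` at `(πi, π²)` / `(1, πi)`) — no stub asserts more than
`n ≤ trdeg` of the full `(x, eˣ)`, and B relativises the SAME inequality (implied by SC via the hull
count, triage r1-1/r1-2); `core_le_eclField` / `eDerivation_apply_eq_zero_of_mem_core` — reproved here
for `M` (`kernelFreeCore_le_eclField`) and honoured: no stub applies an E-derivation to a core element;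
`rank ≤ 1 proved`, `rank_two_through_pi`, `expOnePiAlgebraicIndependent_of_crux` — consistent with the
calibration above (rank 1 of B proved here; rank 2 of A/B open); `schanuel_of_firstFailureForm` (slack:
only the first-failure form of (R) is needed by the route) — not used by this line, recorded for the lead.
-/

noncomputable section

set_option linter.dupNamespace false

namespace Summit.Schanuel.Schanuel.Cruxes.SchanuelOnLogFreeCore.GenericPeriodFibre

open Complex IntermediateField
open Literature.NumberTheory.Transcendental

/-! ## Glue-side vocabulary (local abbreviations; every STUB below inlines them) -/

/-- `exp`-closed and relatively algebraically closed ("EA-closed") intermediate fields of `ℂ/ℚ`. -/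
def IsEA (K : IntermediateField ℚ ℂ) : Prop :=
  (∀ w ∈ K, Complex.exp w ∈ K) ∧ ∀ w : ℂ, IsAlgebraic K w → w ∈ K

/-- The KERNEL-FREE CORE `M = ℚ^{EA} ∩ ℂ`: the smallest EA-closed subfield of `ℂ`
(Macintyre's sector: no period adjoined). -/
def kernelFreeCore : IntermediateField ℚ ℂ :=
  sInf {K : IntermediateField ℚ ℂ | (∀ w ∈ K, Complex.exp w ∈ K) ∧ ∀ w : ℂ, IsAlgebraic K w → w ∈ K}

/-- The FIBRE `F_ω = ℚ(ω)^{EA} ∩ ℂ` of the one-parameter family: the smallest EA-closed subfield of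
`ℂ` containing `ω`. -/
def fibre (ω : ℂ) : IntermediateField ℚ ℂ :=
  sInf {K : IntermediateField ℚ ℂ | ω ∈ K ∧ (∀ w ∈ K, Complex.exp w ∈ K) ∧ ∀ w : ℂ, IsAlgebraic K w → w ∈ K}

/-- The LOG-FREE CORE `C_EA` of the route — verbatim the set-builder inlined in the crux decl; it is
the kernel fibre `fibre (2πi)` (`logFreeCore_eq_fibre`, `rfl`). -/
def logFreeCore : IntermediateField ℚ ℂ :=
  sInf {K : IntermediateField ℚ ℂ | (2 * ↑Real.pi * Complex.I : ℂ) ∈ K ∧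
    (∀ w ∈ K, Complex.exp w ∈ K) ∧ ∀ w : ℂ, IsAlgebraic K w → w ∈ K}

theorem logFreeCore_eq_fibre : logFreeCore = fibre (2 * ↑Real.pi * Complex.I) := rfl

/-- Schanuel's statement for `ℚ`-linearly independent tuples drawn from `K`. -/
def SchanuelOn (K : IntermediateField ℚ ℂ) : Prop :=
  ∀ (n : ℕ) (x : Fin n → ℂ), (∀ i, x i ∈ K) → LinearIndependent ℚ x →
    (n : Cardinal) ≤ Algebra.trdeg ℚ
      ↥(IntermediateField.adjoin ℚ (Set.range x ∪ Set.range (Complex.exp ∘ x)))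

/-- RELATIVE Schanuel of `L` over the base `M`: tuples from `L` that are `ℚ`-linearly independent
modulo `M` have `n ≤ trdeg_M M(x, eˣ)` — the shape of the PROVED tree fact
`kirby_relative_schanuel_complex` (there `M ↦ ℚ(ecl ∅)`, `L ↦ ℂ`). -/
def RelSchanuel (L M : IntermediateField ℚ ℂ) : Prop :=
  ∀ (n : ℕ) (x : Fin n → ℂ), (∀ i, x i ∈ L) →
    LinearIndependent ℚ ((Submodule.span ℚ (M : Set ℂ)).mkQ ∘ x) →
      (n : Cardinal) ≤ Algebra.trdeg ↥M
        ↥(IntermediateField.adjoin ↥M (Set.range x ∪ Set.range (Complex.exp ∘ x)))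

/-- Sanity (definitional): the crux is Schanuel on the log-free core. -/
example : SchanuelOn logFreeCore ↔
    Summit.Schanuel.Schanuel.Theses.RigidCore.SchanuelOnLogFreeCore := Iff.rfl

/-! ## Elementary facts about the `sInf`-families -/

theorem isEA_sInf {𝒮 : Set (IntermediateField ℚ ℂ)} (h : ∀ K ∈ 𝒮, IsEA K) : IsEA (sInf 𝒮) := by
  refine ⟨fun w hw => ?_, fun w hw => ?_⟩
  · rw [IntermediateField.mem_sInf] at hw ⊢
    exact fun K hK => (h K hK).1 w (hw K hK)
  · rw [IntermediateField.mem_sInf]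
    intro K hK
    have hle : sInf 𝒮 ≤ K := sInf_le hK
    letI : Algebra (↥(sInf 𝒮)) (↥K) := (IntermediateField.inclusion hle).toRingHom.toAlgebra
    haveI : IsScalarTower (↥(sInf 𝒮)) (↥K) ℂ := IsScalarTower.of_algebraMap_eq (fun _ => rfl)
    exact (h K hK).2 w (hw.tower_top (↥K))

theorem kernelFreeCore_isEA : IsEA kernelFreeCore :=
  isEA_sInf fun _ hK => hK

theorem fibre_isEA (ω : ℂ) : IsEA (fibre ω) :=
  isEA_sInf fun _ hK => hK.2

theorem mem_fibre_self (ω : ℂ) : ω ∈ fibre ω := by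
  rw [fibre, IntermediateField.mem_sInf]
  exact fun K hK => hK.1

theorem fibre_le {ω : ℂ} {K : IntermediateField ℚ ℂ} (hω : ω ∈ K) (hK : IsEA K) : fibre ω ≤ K :=
  sInf_le ⟨hω, hK.1, hK.2⟩

theorem kernelFreeCore_le_of_isEA {K : IntermediateField ℚ ℂ} (hK : IsEA K) : kernelFreeCore ≤ K :=
  sInf_le ⟨hK.1, hK.2⟩

theorem kernelFreeCore_le_fibre (ω : ℂ) : kernelFreeCore ≤ fibre ω :=
  kernelFreeCore_le_of_isEA (fibre_isEA ω)

/-- Algebraic numbers lie in every EA-closed field, in particular in `M`. -/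
theorem mem_of_isAlgebraic {K : IntermediateField ℚ ℂ} (hK : IsEA K) {a : ℂ} (ha : IsAlgebraic ℚ a) :
    a ∈ K :=
  hK.2 a (ha.tower_top K)

/-- The fibre at an algebraic point is the kernel-free core (only `≤` is needed). -/
theorem fibre_le_kernelFreeCore_of_isAlgebraic {a : ℂ} (ha : IsAlgebraic ℚ a) :
    fibre a ≤ kernelFreeCore :=
  fibre_le (mem_of_isAlgebraic kernelFreeCore_isEA ha) kernelFreeCore_isEA

/-- `ecl ∅` as an intermediate field of `ℂ/ℚ` (tree: `Khovanskii.eclSubfield`). -/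
def eclField : IntermediateField ℚ ℂ :=
  (Khovanskii.eclSubfield (∅ : Set ℂ)).toIntermediateField fun q => by
    rw [Khovanskii.eclSubfield]
    show (algebraMap ℚ ℂ q) ∈ ecl (∅ : Set ℂ)
    rw [show algebraMap ℚ ℂ q = (q : ℂ) from rfl]
    exact Literature.Barriers.Schanuel.ratCast_mem_ecl ∅ q

@[simp] theorem mem_eclField {a : ℂ} : a ∈ eclField ↔ a ∈ ecl (∅ : Set ℂ) := Iff.rfl

theorem coe_eclField : (eclField : Set ℂ) = ecl (∅ : Set ℂ) := rfl

/-- `ecl ∅` is EA-closed (Kirby Lemma 3.3 and §7, both PROVED in the tree). -/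
theorem eclField_isEA : IsEA eclField := by
  refine ⟨fun w hw => Khovanskii.exp_mem_ecl hw, fun w hw => ?_⟩
  obtain ⟨p, hp0, hpw⟩ := hw
  rw [mem_eclField]
  refine Khovanskii.mem_ecl_of_isRoot (p := p.map (algebraMap eclField ℂ)) ?_ ?_ ?_
  · exact (Polynomial.map_ne_zero_iff (algebraMap eclField ℂ).injective).mpr hp0
  · intro n
    rw [Polynomial.coeff_map]
    exact (p.coeff n).2
  · rw [Polynomial.IsRoot, Polynomial.eval_map, ← Polynomial.aeval_def, hpw]

/-- The kernel-free core lies inside `ecl ∅` (disprover's `core_le_eclField` for `M`). -/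
theorem kernelFreeCore_le_eclField : kernelFreeCore ≤ eclField :=
  kernelFreeCore_le_of_isEA eclField_isEA

/-! ## The three stubs -/

/-- **Stub A — Schanuel on the kernel-free core `M` (Macintyre's sector; crux-hard).**
Schanuel's statement for `ℚ`-linearly independent tuples from
`M = sInf {K ≤ ℂ | K exp-closed, K relatively algebraically closed}` (`= kernelFreeCore`, `ℚ^{EA} ∩ ℂ`:
everything constructible from `ℚ` by `exp`, field operations and roots of polynomials — `e`, `e^e`,
`e^{√2}`, `e^{i}`, `cos 1`, … — WITHOUT the period). The fibre-independent conjunct of the horizontal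
split; the restriction of (R) to `M ≤ C_EA` (`kernelFreeCore_le_fibre`), hence implied by (R) and by SC;
equivalent to freeness of `ℚ^{EA}` (Macintyre 1991 / Kirby FPEF §2: "SC on `SK^{EA}` ⟺ `SK^{EA}` free").
STATUS: OPEN, no engine offered by this line. It already forces NoPi `π ∉ M` (chain count: an
EA-construction `u` of `iπ` with `k` new exponentials has `trdeg ℚ(u, e^u) ≤ k`, and either `(u*, iπ)`
is independent — contradiction at rank `k+1` — or `∏ e^{m_j u_j} = ±1` drops the count below `k`), and
NoPi ⟹ `e ⊥ π`, `π ⊥ e^e`, `π ⊥ e^{i}` (`M ∋ e, e^e, e^i` is r.a.c.); it also contains `e ⊥ e^e`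
(`x = (1, e)`) and Lindemann–Weierstrass-over-`M` layers. Barriers `EFunctionValuesAtAlgebraicPoints`,
`LinearSubgroupMethodLimit`, `LargeTranscendenceDegree` bound every known engine for its instances.
Size: a conjecture (XL). Sources: Macintyre APAL 51 (1991); Kirby arXiv:0912.4019 §2, §9;
Bays–Kirby arXiv:1512.04262 p.3. -/
theorem stub_schanuelOnKernelFreeCore :
    ∀ (n : ℕ) (x : Fin n → ℂ),
      (∀ i, x i ∈ (sInf {K : IntermediateField ℚ ℂ | (∀ w ∈ K, Complex.exp w ∈ K) ∧
        ∀ w : ℂ, IsAlgebraic K w → w ∈ K} : IntermediateField ℚ ℂ)) →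
      LinearIndependent ℚ x →
        (n : Cardinal) ≤ Algebra.trdeg ℚ
          ↥(IntermediateField.adjoin ℚ (Set.range x ∪ Set.range (Complex.exp ∘ x))) := by
  sorry

/-- **Stub B — the period is generic over the kernel-free core: relative Schanuel of `C_EA` over `M`
(the crux's arithmetic residue; crux-hard from rank 2).** For tuples `x` from the log-free core
`C_EA` (the crux decl's `sInf`, verbatim) that are `ℚ`-linearly independent MODULO `M` (composition with
the quotient map by `span_ℚ M = M` is independent): `n ≤ trdeg_M M(x, eˣ)`. Verbatim the shape of the
PROVED tree fact `kirby_relative_schanuel_complex` (Kirby 2010 Thm 1.2 at `C = ecl ∅`) with the base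
SHRUNK from `ℚ(ecl ∅)` to `M` and the domain restricted to `C_EA = fibre (2πi)`; it is the kernel-fibre
instance of the family statement `RelSchanuel (fibre ω) kernelFreeCore`, which this file PROVES at every
generic `ω ∉ dcl ∅` (`genericFibre`) and which E-derivations cannot reach at `ω = 2πi ∈ dcl ∅`
(`two_pi_I_mem_dcl_empty`; barrier `AxSchanuelFunctionalNotNumerical`). Implied by SC (hull count:
finite data of `M` sit in a `δ = 0` chain) and by (R); with stub A it gives (R) back (`horizontalSplit`).
STATUS: rank 1 is bookkeeping and PROVED here (`relSchanuel_rank_one`: `x ∉ M` ⟹ `x` transcendental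
over the r.a.c. field `M`); rank 2 is OPEN — `x = (2πi, −4π²)` (independent mod `M` iff `π ∉ M`) asserts
`π, e^{−4π²}` algebraically independent over `M` (⊋ "`e^{π²} ∉ ℚ̄`", open), `x = (πi, π)` asserts
Nesterenko's pair `π, e^{π}` independent over `M`; no engine offered. In Bays–Kirby's `𝔹_P`
(`baysKirby2018_modelsWithoutSchanuel`) the analogue of this conjunct is what FAILS
(`P(exp 1, τ) = 0`), certifying it as the irreducibly arithmetic part. Size: a conjecture (XL).
Sources: Kirby arXiv:0810.4285 Thm 1.2 / Prop 7.2; Bays–Kirby–Wilkie arXiv:0810.4457 Thm 1.3;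
arXiv:1512.04262 §9.2; Waldschmidt2000 §1.4. -/
theorem stub_periodGenericOverCore :
    ∀ (n : ℕ) (x : Fin n → ℂ),
      (∀ i, x i ∈ (sInf {K : IntermediateField ℚ ℂ | (2 * ↑Real.pi * Complex.I : ℂ) ∈ K ∧
        (∀ w ∈ K, Complex.exp w ∈ K) ∧ ∀ w : ℂ, IsAlgebraic K w → w ∈ K} : IntermediateField ℚ ℂ)) →
      LinearIndependent ℚ ((Submodule.span ℚ ((sInf {K : IntermediateField ℚ ℂ |
        (∀ w ∈ K, Complex.exp w ∈ K) ∧ ∀ w : ℂ, IsAlgebraic K w → w ∈ K} :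
          IntermediateField ℚ ℂ) : Set ℂ)).mkQ ∘ x) →
        (n : Cardinal) ≤ Algebra.trdeg
          ↥(sInf {K : IntermediateField ℚ ℂ | (∀ w ∈ K, Complex.exp w ∈ K) ∧
            ∀ w : ℂ, IsAlgebraic K w → w ∈ K} : IntermediateField ℚ ℂ)
          ↥(IntermediateField.adjoin
            ↥(sInf {K : IntermediateField ℚ ℂ | (∀ w ∈ K, Complex.exp w ∈ K) ∧
              ∀ w : ℂ, IsAlgebraic K w → w ∈ K} : IntermediateField ℚ ℂ)
            (Set.range x ∪ Set.range (Complex.exp ∘ x))) := by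
  sorry

/-- **Stub C — LOG-FREE TERM GERMS (the lever; TRUE for every `ω`, provable now; size L).**
Every element `c` of the fibre `F_ω = sInf {K | ω ∈ K, exp-closed, r.a.c.}` is the value at `ω` of a
member `f` of a family `𝒯` of functions, analytic on a disc `ball ω r`, which is closed under `deriv`
and whose members (i) take values `g z ∈ F_z` at EVERY point `z` of the disc and (ii) satisfy the
E-CHAIN RULE `D (g z) = g′(z) · D z` for every E-derivation `D` of `ℂ` (tree `IsEDerivation`:
`Derivation ℤ ℂ ℂ` with `D (exp a) = exp a · D a`; no continuity) at every point of the disc.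
WHY TRUE (the intended proof): let `Term(U)` be the functions on the open disc `U` generated from
`id` and the constants `ℚ` by `+, −, ×`, inverses of members non-vanishing on `U`, `exp ∘ ·`, and
ROOTS: `g` differentiable on `U` with `g(z)^d + Σ_{i<d} fᵢ(z) g(z)^i = 0` and `∂_Y(…)(g z) ≠ 0` on `U`
for coefficient terms `fᵢ`; take `𝒯 := {h | h agrees on U with some t ∈ Term(U)}` (so that `deriv`,
which is local, stays inside). By structural induction: members are complex-differentiable on `U`;
`Term(U)` is closed under the formal derivative, which agrees with `deriv` on `U` (root case:
`g′ = −(Σ fᵢ′ gⁱ)·(∂_Y P(g))⁻¹`, the inverse being a term because `∂_Y P(g)` does not vanish on `U`);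
values lie in `F_z` (`z ∈ F_z`, field operations, `exp`-closure, and a root of a MONIC polynomial with
coefficients in `F_z` is algebraic over `F_z`, hence in it); the E-chain rule (Leibniz, the E-rule at
`exp` nodes, and at root nodes `D` applied to `P_z(g z) = 0` compared with `d/dz` of the same identity,
dividing by `∂_Y P ≠ 0`). Finally `F_ω ≤ {t(ω) : t ∈ Term(ball ω r), r > 0}` because the right side is
an intermediate field containing `ω`, closed under `exp`, and relatively algebraically closed: a `w`
algebraic over it is a SIMPLE root of its minimal polynomial `P` (char 0), and the holomorphic implicit
function theorem (Mathlib `ContDiffAt.implicitFunction`, `ContDiffAt.contDiffAt_implicitFunction` with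
`𝕜 = ℂ`, then `contDiffAt_succ_iff_hasFDerivAt` for differentiability on a neighbourhood) produces the
root germ `g` with `g ω = w` on a smaller disc — log-freeness is used exactly here: with `log` or a
Khovanskii point as a generator the germ class would not be single-valued over `ℚ` from one parameter.
Leans on (Mathlib): `DifferentiableOn`, `deriv`, `HasDerivAt` calculus (`deriv_add/mul/inv`,
`Complex.hasDerivAt_exp`/chain rule), `Filter.EventuallyEq.deriv_eq`, `ContDiffAt.implicitFunction` +
`eventually_apply_implicitFunction` + `contDiffAt_implicitFunction`, `IntermediateField.mem_sInf`,
`minpoly` / `Polynomial.Separable` in char 0 (`IsSeparable`), `Derivation.leibniz`,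
`derivation_mvPolynomial_aeval` / `Derivation.map_aeval` (tree/Mathlib chain rule for polynomials);
tree: `IsEDerivation`, `isEDerivation_iff`. Triage size warning (r1-2): "~500 lines is optimistic
(inductive germ class + IFT + identity principle …): expect 1500+" — the identity principle is NOT
needed in this cut (Taylor on the disc is in the glue), the IFT is. Sources: Kirby arXiv:0810.4285 §4
(E-derivations, Lemma 4.6 chain rule); Bays–Kirby–Wilkie arXiv:0810.4457 Prop 2.1 (the o-minimal,
real-line version of "derivations along terms"); card generic-period-fibre (NoHiddenConstants). -/
theorem stub_termGerm :
    ∀ (ω c : ℂ), c ∈ (sInf {K : IntermediateField ℚ ℂ | ω ∈ K ∧ (∀ w ∈ K, Complex.exp w ∈ K) ∧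
        ∀ w : ℂ, IsAlgebraic K w → w ∈ K} : IntermediateField ℚ ℂ) →
      ∃ r : ℝ, 0 < r ∧ ∃ 𝒯 : Set (ℂ → ℂ), (∃ f ∈ 𝒯, f ω = c) ∧
        ∀ g ∈ 𝒯, DifferentiableOn ℂ g (Metric.ball ω r) ∧ deriv g ∈ 𝒯 ∧
          (∀ z ∈ Metric.ball ω r, g z ∈ (sInf {K : IntermediateField ℚ ℂ | z ∈ K ∧
            (∀ w ∈ K, Complex.exp w ∈ K) ∧ ∀ w : ℂ, IsAlgebraic K w → w ∈ K} : IntermediateField ℚ ℂ)) ∧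
          ∀ z ∈ Metric.ball ω r, ∀ D : Derivation ℤ ℂ ℂ,
            Literature.NumberTheory.Transcendental.IsEDerivation D → D (g z) = deriv g z * D z :=
  -- LANDED (lead, cycle 1, p73975): `Theorems/RigidCoreSchanuelOnLogFreeCoreTermGerm.lean`
  -- (objects `eaFibre`, `kernelFreeCore`, `IsLogFreeTerm` in `Theorems/RigidCoreDefs.lean`, p73836)
  Summit.Schanuel.Schanuel.Theorems.RigidCore.stub_termGerm


/-! ### Landing stubs (lead, cycle 1): the line's objects file and its two deliverable theorems

Registered so that the three remaining `Theorems/` files of the line can land `--supports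
stmt-Schanuel-0970` (the gate requires every such file to prove a registered stub verbatim):
`stub_eaFibre_le_kernelFreeCore` rides with the objects file `Theorems/RigidCoreDefs.lean`
(`eaFibre`, `kernelFreeCore`, `IsLogFreeTerm` + elementary API), and `stub_noHiddenConstants` /
`stub_genericFibre` are the line's DELIVERABLE THEOREMS (the glue `noHiddenConstants_of_termGerm`,
`genericFibre_of_noHiddenConstants` below, transplanted to a `Theorems/` file once stub C has landed).
All three are provable now (the last two modulo stub C, which is proved). None is on the path to
`SchanuelOnLogFreeCore_of`. -/

/-- **Stub D — the fibre at an algebraic point lies in the kernel-free core** (definition-level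
glue, size S). For algebraic `a`: `F_a = sInf {K | a ∈ K, exp-closed, r.a.c.} ≤ M = sInf {K |
exp-closed, r.a.c.}` (indeed `=`), because algebraic numbers lie in every relatively algebraically
closed `K`. Used by NoHiddenConstants (a constant term germ evaluated at an algebraic point of the
disc). -/
theorem stub_eaFibre_le_kernelFreeCore :
    ∀ a : ℂ, IsAlgebraic ℚ a →
      (sInf {K : IntermediateField ℚ ℂ | a ∈ K ∧ (∀ w ∈ K, Complex.exp w ∈ K) ∧
        ∀ w : ℂ, IsAlgebraic K w → w ∈ K} : IntermediateField ℚ ℂ) ≤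
      (sInf {K : IntermediateField ℚ ℂ | (∀ w ∈ K, Complex.exp w ∈ K) ∧
        ∀ w : ℂ, IsAlgebraic K w → w ∈ K} : IntermediateField ℚ ℂ) :=
  -- LANDED (lead, cycle 1, p73836): `Theorems/RigidCoreDefs.lean`
  Summit.Schanuel.Schanuel.Theorems.RigidCore.stub_eaFibre_le_kernelFreeCore

/-- **Stub NHC — NO HIDDEN CONSTANTS** (the line's first deliverable theorem; provable from stub C,
see `noHiddenConstants_of_termGerm`): at a generic parameter `ω ∉ dcl ∅` every element of the fibre
`F_ω` lying in Kirby's derivation closure `dcl ∅` (⊇ `ecl ∅`) already lies in the kernel-free core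
`M`. -/
theorem stub_noHiddenConstants :
    ∀ ω : ℂ, ω ∉ Literature.NumberTheory.Transcendental.dcl (∅ : Set ℂ) →
      ∀ c ∈ (sInf {K : IntermediateField ℚ ℂ | ω ∈ K ∧ (∀ w ∈ K, Complex.exp w ∈ K) ∧
        ∀ w : ℂ, IsAlgebraic K w → w ∈ K} : IntermediateField ℚ ℂ),
        c ∈ Literature.NumberTheory.Transcendental.dcl (∅ : Set ℂ) →
          c ∈ (sInf {K : IntermediateField ℚ ℂ | (∀ w ∈ K, Complex.exp w ∈ K) ∧
            ∀ w : ℂ, IsAlgebraic K w → w ∈ K} : IntermediateField ℚ ℂ) :=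
  -- LANDED (lead -0, cycle 1, p74640): `Theorems/RigidCoreSchanuelOnLogFreeCoreGenericFibre.lean`
  Summit.Schanuel.Schanuel.Theorems.RigidCore.stub_noHiddenConstants

/-- **Stub GF — THE GENERIC-FIBRE THEOREM** (the line's second deliverable theorem; provable from
NHC and Kirby's relative Schanuel theorem over `ecl ∅`, see `genericFibre_of_noHiddenConstants`):
at every generic parameter `ω ∉ dcl ∅`, tuples from `F_ω` that are `ℚ`-linearly independent modulo
`M` satisfy `n ≤ trdeg_M M(x, eˣ)` — the family statement whose excluded kernel-fibre instance
`ω = 2πi ∈ dcl ∅` is stub B. -/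
theorem stub_genericFibre :
    ∀ ω : ℂ, ω ∉ Literature.NumberTheory.Transcendental.dcl (∅ : Set ℂ) →
      ∀ (n : ℕ) (x : Fin n → ℂ),
        (∀ i, x i ∈ (sInf {K : IntermediateField ℚ ℂ | ω ∈ K ∧ (∀ w ∈ K, Complex.exp w ∈ K) ∧
          ∀ w : ℂ, IsAlgebraic K w → w ∈ K} : IntermediateField ℚ ℂ)) →
        LinearIndependent ℚ ((Submodule.span ℚ ((sInf {K : IntermediateField ℚ ℂ |
          (∀ w ∈ K, Complex.exp w ∈ K) ∧ ∀ w : ℂ, IsAlgebraic K w → w ∈ K} :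
            IntermediateField ℚ ℂ) : Set ℂ)).mkQ ∘ x) →
          (n : Cardinal) ≤ Algebra.trdeg
            ↥(sInf {K : IntermediateField ℚ ℂ | (∀ w ∈ K, Complex.exp w ∈ K) ∧
              ∀ w : ℂ, IsAlgebraic K w → w ∈ K} : IntermediateField ℚ ℂ)
            ↥(IntermediateField.adjoin
              ↥(sInf {K : IntermediateField ℚ ℂ | (∀ w ∈ K, Complex.exp w ∈ K) ∧
                ∀ w : ℂ, IsAlgebraic K w → w ∈ K} : IntermediateField ℚ ℂ)
              (Set.range x ∪ Set.range (Complex.exp ∘ x))) :=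
  -- LANDED (lead -0, cycle 1, p74640): `Theorems/RigidCoreSchanuelOnLogFreeCoreGenericFibre.lean`
  Summit.Schanuel.Schanuel.Theorems.RigidCore.stub_genericFibre


/-! ### Calibration stubs (lead, cycle 1): where A and B stop — landing forms of the wave-1 certificates

Registered so that the workers' kernel-checked CALIBRATION of the two open stubs can land under
`Theorems/` (`--supports stmt-Schanuel-0970`) instead of living only as item evidence. They do
not move the crux; they pin down its residue: A ⊇ `e ⊥ π` (indeed A ⟹ `π ∉ M`), B is vacuous iff
`π ∈ M` and otherwise ⊇ the transcendence of `e^{π²}`; `SchanuelConjecture ⟹ B` (certificate,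
658 lines, evidence only). -/

/-- **Calibration A — stub A implies `e ⊥ π`** (the tree's open statement
`Literature.NumberTheory.Transcendental.ExpOnePiAlgebraicIndependent`, `@[conjecture]`): dichotomy on
`π ∈ M` — if `π ∈ M`, stub A at the `ℚ`-independent pair `(1, πi) ⊂ M` gives
`2 ≤ trdeg ℚ(1, πi, e, −1) = trdeg ℚ(π, e)`; if `π ∉ M`, `π` is transcendental over the relatively
algebraically closed field `M ∋ e` (stub-worker A, certificate `stub_schanuelOnKernelFreeCore.lean`). -/
theorem stub_calibA_expOnePi :
    (∀ (n : ℕ) (x : Fin n → ℂ),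
      (∀ i, x i ∈ (sInf {K : IntermediateField ℚ ℂ | (∀ w ∈ K, Complex.exp w ∈ K) ∧
        ∀ w : ℂ, IsAlgebraic K w → w ∈ K} : IntermediateField ℚ ℂ)) →
      LinearIndependent ℚ x →
        (n : Cardinal) ≤ Algebra.trdeg ℚ
          ↥(IntermediateField.adjoin ℚ (Set.range x ∪ Set.range (Complex.exp ∘ x)))) →
    Literature.NumberTheory.Transcendental.ExpOnePiAlgebraicIndependent :=
  -- LANDED (lead -0, cycle 1, p75332): `Theorems/RigidCoreSchanuelOnLogFreeCoreCalibrationA.lean`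
  Summit.Schanuel.Schanuel.Theorems.RigidCore.stub_calibA_expOnePi

/-- **Calibration B₁ — if `π ∈ M`, stub B holds VACUOUSLY**: then `C_EA = M` and no non-empty tuple
from `C_EA` is `ℚ`-linearly independent modulo `M` (stub-worker B, certificate
`stub_periodGenericOverCore.lean`). So B has content exactly when `π ∉ M` (open, implied by SC). -/
theorem stub_calibB_vacuous :
    (Real.pi : ℂ) ∈ (sInf {K : IntermediateField ℚ ℂ | (∀ w ∈ K, Complex.exp w ∈ K) ∧
        ∀ w : ℂ, IsAlgebraic K w → w ∈ K} : IntermediateField ℚ ℂ) →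
    ∀ (n : ℕ) (x : Fin n → ℂ),
      (∀ i, x i ∈ (sInf {K : IntermediateField ℚ ℂ | (2 * ↑Real.pi * Complex.I : ℂ) ∈ K ∧
        (∀ w ∈ K, Complex.exp w ∈ K) ∧ ∀ w : ℂ, IsAlgebraic K w → w ∈ K} : IntermediateField ℚ ℂ)) →
      LinearIndependent ℚ ((Submodule.span ℚ ((sInf {K : IntermediateField ℚ ℂ |
        (∀ w ∈ K, Complex.exp w ∈ K) ∧ ∀ w : ℂ, IsAlgebraic K w → w ∈ K} :
          IntermediateField ℚ ℂ) : Set ℂ)).mkQ ∘ x) →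
        (n : Cardinal) ≤ Algebra.trdeg
          ↥(sInf {K : IntermediateField ℚ ℂ | (∀ w ∈ K, Complex.exp w ∈ K) ∧
            ∀ w : ℂ, IsAlgebraic K w → w ∈ K} : IntermediateField ℚ ℂ)
          ↥(IntermediateField.adjoin
            ↥(sInf {K : IntermediateField ℚ ℂ | (∀ w ∈ K, Complex.exp w ∈ K) ∧
              ∀ w : ℂ, IsAlgebraic K w → w ∈ K} : IntermediateField ℚ ℂ)
            (Set.range x ∪ Set.range (Complex.exp ∘ x))) :=
  -- LANDED (lead -0, cycle 1, p75670): `Theorems/RigidCoreSchanuelOnLogFreeCoreCalibrationB.lean`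
  Summit.Schanuel.Schanuel.Theorems.RigidCore.stub_calibB_vacuous

/-- **Calibration B₂ — stub B and `π ∉ M` give the transcendence of `e^{π²}`** (printed open;
Waldschmidt): B at the tuple `(2πi, (2πi)²) ⊂ C_EA`, independent modulo `M` iff `π ∉ M`, makes
`2πi, e^{−4π²}` algebraically independent over `M ⊇ ℚ̄` (stub-worker B, certificate
`stub_periodGenericOverCore.lean`). -/
theorem stub_calibB_expPiSq :
    (∀ (n : ℕ) (x : Fin n → ℂ),
      (∀ i, x i ∈ (sInf {K : IntermediateField ℚ ℂ | (2 * ↑Real.pi * Complex.I : ℂ) ∈ K ∧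
        (∀ w ∈ K, Complex.exp w ∈ K) ∧ ∀ w : ℂ, IsAlgebraic K w → w ∈ K} : IntermediateField ℚ ℂ)) →
      LinearIndependent ℚ ((Submodule.span ℚ ((sInf {K : IntermediateField ℚ ℂ |
        (∀ w ∈ K, Complex.exp w ∈ K) ∧ ∀ w : ℂ, IsAlgebraic K w → w ∈ K} :
          IntermediateField ℚ ℂ) : Set ℂ)).mkQ ∘ x) →
        (n : Cardinal) ≤ Algebra.trdeg
          ↥(sInf {K : IntermediateField ℚ ℂ | (∀ w ∈ K, Complex.exp w ∈ K) ∧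
            ∀ w : ℂ, IsAlgebraic K w → w ∈ K} : IntermediateField ℚ ℂ)
          ↥(IntermediateField.adjoin
            ↥(sInf {K : IntermediateField ℚ ℂ | (∀ w ∈ K, Complex.exp w ∈ K) ∧
              ∀ w : ℂ, IsAlgebraic K w → w ∈ K} : IntermediateField ℚ ℂ)
            (Set.range x ∪ Set.range (Complex.exp ∘ x)))) →
    (Real.pi : ℂ) ∉ (sInf {K : IntermediateField ℚ ℂ | (∀ w ∈ K, Complex.exp w ∈ K) ∧
        ∀ w : ℂ, IsAlgebraic K w → w ∈ K} : IntermediateField ℚ ℂ) →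
      Transcendental ℚ (Real.exp (Real.pi ^ 2)) :=
  -- LANDED (lead -0, cycle 1, p75670): `Theorems/RigidCoreSchanuelOnLogFreeCoreCalibrationB.lean`
  Summit.Schanuel.Schanuel.Theorems.RigidCore.stub_calibB_expPiSq


/-! ### Landing stubs (lead -1, cycle 1): the EXACT SPLIT and two more calibrations

Registered so that three further `Theorems/` files can land `--supports stmt-Schanuel-0970`. None is on the
path to `SchanuelOnLogFreeCore_of`; S1 certifies that the path loses nothing ((R) ⟺ A ∧ B), so that the planner
can promote A and B to items with tree-level glue; S2 calibrates the crux itself against the Baker side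
(ideator-2 finding); S3 sharpens the reading of B under A (B is never vacuous once A holds). -/

/-- **Stub S1 — THE SPLIT IS EXACT: `(R) ⟺ A ∧ B`** (provable now; size M). `⇐` is `horizontalSplit` at
`M = kernelFreeCore`, `L = logFreeCore` (this file, sorry-free). `⇒`: A is the restriction of (R) along
`M ≤ C_EA`; B follows from (R) by the HULL COUNT — every finite subset of `M` lies in a finite-dimensional
`ℚ`-subspace `V ≤ M`, closed under nothing but chosen so that `trdeg ℚ(V, e^V) = dim V` (predimension `0`,
forced DOWN by the EA-construction of `M` and UP by (R) on `M ≤ C_EA`), and then (R) at an adapted basis of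
`V ⊕ span x` minus the hull's own count leaves `n ≤ trdeg_M M(x, eˣ)` (drefuter's kernel-checked
`SplitExact.lean`, `DrefuteGPF.stubB_of_crux`, in the tree's GammaField predimension calculus). -/
theorem stub_splitExact :
    Summit.Schanuel.Schanuel.Theses.RigidCore.SchanuelOnLogFreeCore ↔
    ((∀ (n : ℕ) (x : Fin n → ℂ),
      (∀ i, x i ∈ (sInf {K : IntermediateField ℚ ℂ | (∀ w ∈ K, Complex.exp w ∈ K) ∧
        ∀ w : ℂ, IsAlgebraic K w → w ∈ K} : IntermediateField ℚ ℂ)) →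
      LinearIndependent ℚ x →
        (n : Cardinal) ≤ Algebra.trdeg ℚ
          ↥(IntermediateField.adjoin ℚ (Set.range x ∪ Set.range (Complex.exp ∘ x)))) ∧
     (∀ (n : ℕ) (x : Fin n → ℂ),
      (∀ i, x i ∈ (sInf {K : IntermediateField ℚ ℂ | (2 * ↑Real.pi * Complex.I : ℂ) ∈ K ∧
        (∀ w ∈ K, Complex.exp w ∈ K) ∧ ∀ w : ℂ, IsAlgebraic K w → w ∈ K} : IntermediateField ℚ ℂ)) →
      LinearIndependent ℚ ((Submodule.span ℚ ((sInf {K : IntermediateField ℚ ℂ |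
        (∀ w ∈ K, Complex.exp w ∈ K) ∧ ∀ w : ℂ, IsAlgebraic K w → w ∈ K} :
          IntermediateField ℚ ℂ) : Set ℂ)).mkQ ∘ x) →
        (n : Cardinal) ≤ Algebra.trdeg
          ↥(sInf {K : IntermediateField ℚ ℂ | (∀ w ∈ K, Complex.exp w ∈ K) ∧
            ∀ w : ℂ, IsAlgebraic K w → w ∈ K} : IntermediateField ℚ ℂ)
          ↥(IntermediateField.adjoin
            ↥(sInf {K : IntermediateField ℚ ℂ | (∀ w ∈ K, Complex.exp w ∈ K) ∧
              ∀ w : ℂ, IsAlgebraic K w → w ∈ K} : IntermediateField ℚ ℂ)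
            (Set.range x ∪ Set.range (Complex.exp ∘ x))))) := by
  sorry

/-- **Stub S2 — calibration of the crux against the Baker side: `(R) ⟹ π ⊥ log 2`**
(`AlgebraicIndependent ℚ ![Real.pi, Real.log 2]` = `ToricPeriods.PiLogTwoAlgIndep`, printed OPEN: Waldschmidt
2000 §1.4, Roy 1992 p. 22; provable now, size S–M). Dichotomy on `log 2 ∈ C_EA`: if it is, (R) at the
`ℚ`-independent pair `(2πi, log 2) ⊂ C_EA` gives `2 ≤ trdeg ℚ(2πi, log 2, 1, 2) = trdeg ℚ(π, log 2)`; if it is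
not, `log 2` is transcendental over the relatively algebraically closed field `C_EA ∋ π`. (Ideator-2 finding
`finding-r-implies-pilogalgindep`: so (R) is NOT disjoint from the "symmetric side" its docstring excludes —
a refutation of `PiLogTwoAlgIndep` refutes (R).) -/
theorem stub_calibR_piLogTwo :
    Summit.Schanuel.Schanuel.Theses.RigidCore.SchanuelOnLogFreeCore →
      AlgebraicIndependent ℚ ![Real.pi, Real.log 2] := by
  sorry

/-- **Stub S3 — NoPi: stub A alone puts `π` outside the kernel-free core `M`** (provable now, size M–L).
HULL LEMMA: `M ≤ ⋃ ℚ(l, e^l)^{alg}` over EA-construction sequences `l ⊂ M` (each `l_j` algebraic over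
`ℚ(l_{<j}, e^{l_{<j}})` or the exponential of such an element); along a sequence `trdeg ℚ(l, e^l) ≤ dim span l`;
if `πi ∈ ℚ(l, e^l)^{alg}` then A at a cleared-denominator basis of `span(πi, l) ⊂ M` forces
`dim span(πi, l) ≤ trdeg ℚ(πi, l, e^{πi}, e^l) = trdeg ℚ(l, e^l) ≤ dim span l`, so `πi ∈ span l`, and descending
along the sequence gives `πi ∈ ℚ`, absurd (lead -0's worker certificate `stub_schanuelOnKernelFreeCore_noPi.lean`,
517 lines, evidence only). Consequence: under A, `C_EA ≠ M` and stub B is non-vacuous (CalibrationB). -/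
theorem stub_calibA_noPi :
    (∀ (n : ℕ) (x : Fin n → ℂ),
      (∀ i, x i ∈ (sInf {K : IntermediateField ℚ ℂ | (∀ w ∈ K, Complex.exp w ∈ K) ∧
        ∀ w : ℂ, IsAlgebraic K w → w ∈ K} : IntermediateField ℚ ℂ)) →
      LinearIndependent ℚ x →
        (n : Cardinal) ≤ Algebra.trdeg ℚ
          ↥(IntermediateField.adjoin ℚ (Set.range x ∪ Set.range (Complex.exp ∘ x)))) →
    (Real.pi : ℂ) ∉ (sInf {K : IntermediateField ℚ ℂ | (∀ w ∈ K, Complex.exp w ∈ K) ∧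
        ∀ w : ℂ, IsAlgebraic K w → w ∈ K} : IntermediateField ℚ ℂ) := by
  sorry


/-- **Stub S1a — THE HORIZONTAL SPLIT, general form** (landing ticket for the glue `horizontalSplit`
below, which is PROVED in this file; size M). For intermediate fields `M, L` of `ℂ/ℚ` with `M` closed
under `exp`: Schanuel on `M` and relative Schanuel of `L` over `M` give Schanuel on `L` — the architecture
of Kirby's `SC ⟺ SC on ecl ∅` (tree `schanuelConjecture_iff_ecl_empty_of_kirby`) with `ecl ∅ ↦ M`.
Registered so that the split file S1 can import it from `Theorems/` instead of re-proving it. -/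
theorem stub_horizontalSplit :
    ∀ (M L : IntermediateField ℚ ℂ), (∀ w ∈ M, Complex.exp w ∈ M) →
      (∀ (n : ℕ) (x : Fin n → ℂ), (∀ i, x i ∈ M) → LinearIndependent ℚ x →
        (n : Cardinal) ≤ Algebra.trdeg ℚ
          ↥(IntermediateField.adjoin ℚ (Set.range x ∪ Set.range (Complex.exp ∘ x)))) →
      (∀ (n : ℕ) (x : Fin n → ℂ), (∀ i, x i ∈ L) →
        LinearIndependent ℚ ((Submodule.span ℚ (M : Set ℂ)).mkQ ∘ x) →
          (n : Cardinal) ≤ Algebra.trdeg ↥M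
            ↥(IntermediateField.adjoin ↥M (Set.range x ∪ Set.range (Complex.exp ∘ x)))) →
      ∀ (n : ℕ) (x : Fin n → ℂ), (∀ i, x i ∈ L) → LinearIndependent ℚ x →
        (n : Cardinal) ≤ Algebra.trdeg ℚ
          ↥(IntermediateField.adjoin ℚ (Set.range x ∪ Set.range (Complex.exp ∘ x))) := by
  sorry

/-- **Stub S3a — EXHAUSTION OF THE KERNEL-FREE CORE BY EA-CONSTRUCTION SEQUENCES** (the hull lemma
behind S3 and behind `SC ⟹ B`; provable now, size M). Every element of `M = sInf {K | exp-closed, r.a.c.}`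
is a member of a finite sequence `l = (l₀, …, l_{k−1})` in which each `l_j` is ALGEBRAIC over
`ℚ(l_i, e^{l_i} : i < j)`. Proof: the set `H` of all members of such sequences is (the carrier of) an
intermediate field (concatenate sequences; sums/products/inverses are algebraic over the union), closed
under `exp` (append `e^{l_j}`, which is even IN the previous field) and relatively algebraically closed
(a `w` algebraic over `H` is algebraic over finitely many members — `Polynomial` coefficients — hence over one
concatenated sequence); so `M = sInf ≤ H` (`sInf_le`). Conversely every member of such a sequence lies in `M`
(induction: `M` is r.a.c. and exp-closed), which the landed file should also record. -/
theorem stub_kernelFreeCore_exhaust :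
    ∀ a ∈ (sInf {K : IntermediateField ℚ ℂ | (∀ w ∈ K, Complex.exp w ∈ K) ∧
        ∀ w : ℂ, IsAlgebraic K w → w ∈ K} : IntermediateField ℚ ℂ),
      ∃ (k : ℕ) (l : Fin k → ℂ), a ∈ Set.range l ∧
        ∀ j : Fin k, IsAlgebraic
          ↥(IntermediateField.adjoin ℚ (l '' {i | i < j} ∪ Complex.exp '' (l '' {i | i < j}))) (l j) := by
  sorry

/-! ### Stub C reshaped (lead, cycle 1): two Mathlib-only analytic sub-stubs of `stub_termGerm`

The line card allows reshaping C "along its inductions". The two pieces below are the self-contained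
ANALYTIC inputs of the intended proof of `stub_termGerm` (its ROOT nodes), stated over Mathlib only so
that a `Theorems/` file can prove each verbatim and the proof of `stub_termGerm` can import them:
`stub_rootGerm` = the holomorphic implicit-function step that makes the value field relatively
algebraically closed, `stub_implicitDeriv` = implicit differentiation of the root identity (the
`d/dz`-side of the E-chain rule at root nodes and the formula for the derivative term). Neither is on
the path to `SchanuelOnLogFreeCore_of` (like `stub_termGerm` itself they serve the generic-fibre
theorems); the composition of the crux from stubs A and B is unchanged. In both, the summand `i = 0` of
the `∂_Y`-expression `d·g^{d-1} + Σ i·aᵢ·g^{i-1}` vanishes (factor `(i : ℂ) = 0`), so the `ℕ`-subtraction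
`i - 1` carries no junk; `d = 0` is vacuous (the root identity would read `1 = 0`). -/

/-- **Stub C1 — holomorphic ROOT GERM (implicit function theorem; provable now, size M).**
If the coefficient functions `aᵢ` are complex-differentiable on the disc `ball ω r` and `w` is a
SIMPLE root of the monic polynomial `Y^d + Σ_{i<d} aᵢ(ω) Yⁱ` (the `∂_Y`-value at `(ω, w)` is non-zero),
then there is a function `g` with `g ω = w` which, on a smaller disc `ball ω r'` (`0 < r' ≤ r`), is
complex-differentiable, satisfies the root identity `g(z)^d + Σ aᵢ(z) g(z)ⁱ = 0`, and stays a simple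
root (`∂_Y ≠ 0`). Intended proof: `F : ℂ × ℂ → ℂ`, `F (z, Y) = Y^d + Σ aᵢ(z) Yⁱ` is `ContDiffAt ℂ n`
at `(ω, w)` (the `aᵢ` are analytic on the open disc: `DifferentiableOn.analyticAt`), its partial
`fderiv ℂ F (ω,w) ∘L inr` is multiplication by `∂_Y F (ω, w) ≠ 0`, hence invertible; Mathlib's
`ContDiffAt.implicitFunction` / `implicitFunction_apply_self` / `eventually_apply_implicitFunction` /
`contDiffAt_implicitFunction` (file `Mathlib/Analysis/Calculus/ImplicitContDiff.lean`, `𝕜 = ℂ`) give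
`g`; `ContDiffAt.eventually` + `ContDiffAt.differentiableAt` give differentiability near `ω`,
continuity of `z ↦ ∂_Y F (z, g z)` at `ω` keeps the root simple near `ω`; intersect the three
neighbourhoods with `ball ω r` (`Metric.eventually_nhds_iff_ball`). -/
theorem stub_rootGerm :
    ∀ (d : ℕ) (a : Fin d → ℂ → ℂ) (ω w : ℂ) (r : ℝ), 0 < r →
      (∀ i, DifferentiableOn ℂ (a i) (Metric.ball ω r)) →
      w ^ d + ∑ i : Fin d, a i ω * w ^ (i : ℕ) = 0 →
      (d : ℂ) * w ^ (d - 1) + ∑ i : Fin d, ((i : ℕ) : ℂ) * a i ω * w ^ ((i : ℕ) - 1) ≠ 0 →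
        ∃ g : ℂ → ℂ, g ω = w ∧ ∃ r' : ℝ, 0 < r' ∧ r' ≤ r ∧
          DifferentiableOn ℂ g (Metric.ball ω r') ∧
          (∀ z ∈ Metric.ball ω r', g z ^ d + ∑ i : Fin d, a i z * g z ^ (i : ℕ) = 0) ∧
          (∀ z ∈ Metric.ball ω r',
            (d : ℂ) * g z ^ (d - 1) + ∑ i : Fin d, ((i : ℕ) : ℂ) * a i z * g z ^ ((i : ℕ) - 1) ≠ 0) :=
  -- LANDED (wave 1, p71340): `Theorems/RigidCoreSchanuelOnLogFreeCoreRootGerm.lean`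
  Summit.Schanuel.Schanuel.Theorems.RigidCore.stub_rootGerm

/-- **Stub C2 — IMPLICIT DIFFERENTIATION of the root identity (provable now, size S).**
If `aᵢ` has derivative `aᵢ'` at `z`, `g` has derivative `g'` at `z`, and the root identity
`g(w)^d + Σ aᵢ(w) g(w)ⁱ = 0` holds for `w` near `z`, then differentiating it gives the linear relation
`g' · (d·g(z)^{d-1} + Σ i·aᵢ(z)·g(z)^{i-1}) + Σ aᵢ'·g(z)ⁱ = 0` (so `g' = −(Σ aᵢ' gⁱ)/∂_Y` at a simple
root). Intended proof: `HasDerivAt` of the left side by `HasDerivAt.pow/mul/add/sum` (Mathlib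
`HasDerivAt.fun_sum` / `HasDerivAt.finset_sum`), `HasDerivAt` of the constant `0` transported along the
eventual equality (`Filter.EventuallyEq.hasDerivAt_iff` / `HasDerivAt.congr_of_eventuallyEq`), and
uniqueness of the derivative (`HasDerivAt.unique`). -/
theorem stub_implicitDeriv :
    ∀ (d : ℕ) (a : Fin d → ℂ → ℂ) (a' : Fin d → ℂ) (g : ℂ → ℂ) (z g' : ℂ),
      (∀ i, HasDerivAt (a i) (a' i) z) → HasDerivAt g g' z →
      (∀ᶠ w in nhds z, g w ^ d + ∑ i : Fin d, a i w * g w ^ (i : ℕ) = 0) →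
        g' * ((d : ℂ) * g z ^ (d - 1) + ∑ i : Fin d, ((i : ℕ) : ℂ) * a i z * g z ^ ((i : ℕ) - 1)) +
          ∑ i : Fin d, a' i * g z ^ (i : ℕ) = 0 :=
  -- LANDED (wave 1, p71467): `Theorems/RigidCoreSchanuelOnLogFreeCoreImplicitDeriv.lean`
  Summit.Schanuel.Schanuel.Theorems.RigidCore.stub_implicitDeriv

/-! ## Glue 1 (sorry-free): the horizontal split along an exp-closed base -/

open Submodule in
/-- **Horizontal split (general form).** For intermediate fields `M, L` of `ℂ/ℚ` with `M`
closed under `exp`: Schanuel on `M` and relative Schanuel of `L` over `M` give Schanuel on `L`.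
Adapted basis `span x = (span x ∩ M) ⊕ U`, Schanuel on `M` for a basis `y'` of the first summand,
`Rel_M` for a basis `z'` of the second (independent modulo `M`), base change along
`ℚ(y', e^{y'}) ≤ M` (`trdeg_adjoin_le_of_le`) and the tower law (`add_le_trdeg_adjoin_union`) —
the architecture of the tree's `schanuelConjecture_iff_ecl_empty_of_kirby` with `ecl ∅ ↦ M`. -/
theorem horizontalSplit {M L : IntermediateField ℚ ℂ} (hMexp : ∀ w ∈ M, Complex.exp w ∈ M)
    (hA : SchanuelOn M) (hB : RelSchanuel L M) : SchanuelOn L := by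
  intro n x hxL hx
  -- `M` and `L` as `ℚ`-subspaces of `ℂ`
  let Eq : Submodule ℚ ℂ := Subalgebra.toSubmodule M.toSubalgebra
  have hEq : (Eq : Set ℂ) = (M : Set ℂ) := rfl
  have hspanE : span ℚ (M : Set ℂ) = Eq := by rw [← hEq, span_eq]
  let Lq : Submodule ℚ ℂ := Subalgebra.toSubmodule L.toSubalgebra
  -- the `ℚ`-span `V` of `x̄`, `W = V ∩ M` and a complement `U` of `W` in `V`
  set V : Submodule ℚ ℂ := span ℚ (Set.range x) with hV
  have hVL : V ≤ Lq := span_le.mpr (Set.range_subset_iff.mpr hxL)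
  haveI : FiniteDimensional ℚ V := FiniteDimensional.span_of_finite ℚ (Set.finite_range x)
  set W : Submodule ℚ ℂ := V ⊓ Eq with hW
  obtain ⟨U', hU'⟩ := W.exists_isCompl
  set U : Submodule ℚ ℂ := V ⊓ U' with hU
  haveI : FiniteDimensional ℚ W := Submodule.finiteDimensional_of_le inf_le_left
  haveI : FiniteDimensional ℚ U := Submodule.finiteDimensional_of_le inf_le_left
  have hWU_sup : W ⊔ U = V := by
    rw [hU, inf_comm, ← sup_inf_assoc_of_le U' (inf_le_left : W ≤ V), hU'.sup_eq_top, top_inf_eq]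
  have hWU_disj : Disjoint W U := hU'.disjoint.mono_right inf_le_right
  have hUE_disj : Disjoint U Eq := by
    rw [disjoint_def]
    intro a haU haE
    exact (disjoint_def.mp hWU_disj) a ⟨inf_le_left (b := U') haU, haE⟩ haU
  -- dimensions
  set k := Module.finrank ℚ W
  set m := Module.finrank ℚ U
  have hn : k + m = n := by
    have h1 := Submodule.finrank_sup_add_finrank_inf_eq W U
    rw [hWU_disj.eq_bot, finrank_bot, add_zero, hWU_sup] at h1
    rw [← h1, hV, finrank_span_eq_card hx, Fintype.card_fin]
  -- bases
  let bW := Module.finBasis ℚ W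
  let bU := Module.finBasis ℚ U
  let y : Fin k → ℂ := fun i => (bW i : ℂ)
  let z : Fin m → ℂ := fun j => (bU j : ℂ)
  have hy_mem : ∀ i, y i ∈ M := fun i => ((bW i).2 : (bW i : ℂ) ∈ V ⊓ Eq).2
  have hy_V : ∀ i, y i ∈ V := fun i => ((bW i).2 : (bW i : ℂ) ∈ V ⊓ Eq).1
  have hz_U : ∀ j, z j ∈ U := fun j => (bU j).2
  have hz_V : ∀ j, z j ∈ V := fun j => inf_le_left (b := U') (hz_U j)
  have hy_li : LinearIndependent ℚ y := bW.linearIndependent.map' W.subtype W.ker_subtype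
  have hz_li : LinearIndependent ℚ z := bU.linearIndependent.map' U.subtype U.ker_subtype
  -- clearing denominators
  choose Ny hNy hNy_mem using fun i => exists_nsmul_mem_span_int x (hy_V i)
  choose Nz hNz hNz_mem using fun j => exists_nsmul_mem_span_int x (hz_V j)
  let cy : Fin k → ℚˣ := fun i => Units.mk0 (Ny i : ℚ) (Nat.cast_ne_zero.mpr (hNy i))
  let cz : Fin m → ℚˣ := fun j => Units.mk0 (Nz j : ℚ) (Nat.cast_ne_zero.mpr (hNz j))
  let y' : Fin k → ℂ := fun i => (Ny i : ℚ) • y i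
  let z' : Fin m → ℂ := fun j => (Nz j : ℚ) • z j
  have hy'_eq : cy • y = y' := by
    funext i; simp only [Pi.smul_apply', cy, y', Units.smul_def, Units.val_mk0]
  have hz'_eq : cz • z = z' := by
    funext j; simp only [Pi.smul_apply', cz, z', Units.smul_def, Units.val_mk0]
  have hy'_li : LinearIndependent ℚ y' := hy'_eq ▸ hy_li.units_smul cy
  have hz'_li : LinearIndependent ℚ z' := hz'_eq ▸ hz_li.units_smul cz
  have hy'_mem : ∀ i, y' i ∈ M := fun i => Eq.smul_mem _ (hy_mem i)
  have hz'_U : ∀ j, z' j ∈ U := fun j => U.smul_mem _ (hz_U j)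
  have hz'_L : ∀ j, z' j ∈ L := fun j => hVL (inf_le_left (b := U') (hz'_U j))
  have hz'_modE : LinearIndependent ℚ ((span ℚ (M : Set ℂ)).mkQ ∘ z') := by
    refine hz'_li.map ?_
    rw [ker_mkQ, hspanE]
    exact hUE_disj.mono_left (span_le.mpr (Set.range_subset_iff.mpr hz'_U))
  -- the field-theoretic estimate
  set Sy := Set.range y' ∪ Set.range (Complex.exp ∘ y') with hSy
  set Sz := Set.range z' ∪ Set.range (Complex.exp ∘ z') with hSz
  set Ky := adjoin ℚ Sy with hKy
  have hk : (k : Cardinal) ≤ Algebra.trdeg ℚ Ky := hA k y' hy'_mem hy'_li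
  have hm₀ : (m : Cardinal) ≤ Algebra.trdeg M (adjoin M Sz) := hB m z' hz'_L hz'_modE
  have hKyM : Ky ≤ M := by
    rw [hKy, adjoin_le_iff]
    rintro a (⟨i, rfl⟩ | ⟨i, rfl⟩)
    · exact hy'_mem i
    · exact hMexp _ (hy'_mem i)
  have hm : (m : Cardinal) ≤ Algebra.trdeg Ky (adjoin Ky Sz) :=
    hm₀.trans (trdeg_adjoin_le_of_le hKyM Sz)
  have hkm : (k : Cardinal) + m ≤ Algebra.trdeg ℚ (adjoin ℚ (Sy ∪ Sz)) :=
    add_le_trdeg_adjoin_union Sy Sz hk hm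
  -- comparison with `ℚ(x̄, e^{x̄})`
  set Kx := adjoin ℚ (Set.range x ∪ Set.range (Complex.exp ∘ x)) with hKx
  have hle : adjoin ℚ (Sy ∪ Sz) ≤ Kx := by
    rw [adjoin_le_iff]
    rintro a ((⟨i, rfl⟩ | ⟨i, rfl⟩) | (⟨j, rfl⟩ | ⟨j, rfl⟩))
    · exact (mem_adjoin_of_mem_span_int x (hNy_mem i)).1
    · exact (mem_adjoin_of_mem_span_int x (hNy_mem i)).2
    · exact (mem_adjoin_of_mem_span_int x (hNz_mem j)).1
    · exact (mem_adjoin_of_mem_span_int x (hNz_mem j)).2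
  have hfin : Algebra.trdeg ℚ (adjoin ℚ (Sy ∪ Sz)) ≤ Algebra.trdeg ℚ Kx :=
    trdeg_le_of_injective (inclusion hle) (inclusion_injective hle)
  calc (n : Cardinal) = (k : Cardinal) + m := by rw [← hn, Nat.cast_add]
    _ ≤ Algebra.trdeg ℚ (adjoin ℚ (Sy ∪ Sz)) := hkm
    _ ≤ Algebra.trdeg ℚ Kx := hfin

/-! ## Glue 2 (sorry-free): no hidden constants in a generic fibre -/

/-- NO HIDDEN CONSTANTS: at a generic parameter `ω ∉ dcl ∅` (Kirby's derivation closure; `= ecl ∅`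
by Kirby 2010 Thm 1.1) every exponentially-algebraic — indeed every `dcl ∅` — element of the fibre
`F_ω` already lies in the kernel-free core `M`. -/
def NoHiddenConstants : Prop :=
  ∀ ω : ℂ, ω ∉ dcl (∅ : Set ℂ) → ∀ c ∈ fibre ω, c ∈ dcl (∅ : Set ℂ) → c ∈ kernelFreeCore

/-- There is a `ℚ(i)`-rational (hence algebraic) point in every open disc. -/
theorem exists_isAlgebraic_mem_ball (ω : ℂ) {r : ℝ} (hr : 0 < r) :
    ∃ a ∈ Metric.ball ω r, IsAlgebraic ℚ a := by
  obtain ⟨p, hp₁, hp₂⟩ := exists_rat_btwn (show ω.re - r / 2 < ω.re + r / 2 by linarith)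
  obtain ⟨q, hq₁, hq₂⟩ := exists_rat_btwn (show ω.im - r / 2 < ω.im + r / 2 by linarith)
  refine ⟨(p : ℂ) + (q : ℂ) * Complex.I, ?_, ?_⟩
  · rw [Metric.mem_ball, dist_eq_norm]
    refine (Complex.norm_le_abs_re_add_abs_im _).trans_lt ?_
    have h1 : ((p : ℂ) + (q : ℂ) * Complex.I - ω).re = (p : ℝ) - ω.re := by simp
    have h2 : ((p : ℂ) + (q : ℂ) * Complex.I - ω).im = (q : ℝ) - ω.im := by simp
    rw [h1, h2]
    have h3 : |(p : ℝ) - ω.re| < r / 2 := abs_sub_lt_iff.mpr ⟨by linarith, by linarith⟩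
    have h4 : |(q : ℝ) - ω.im| < r / 2 := abs_sub_lt_iff.mpr ⟨by linarith, by linarith⟩
    linarith
  · have hp : IsAlgebraic ℚ (p : ℂ) := by
      rw [show (p : ℂ) = algebraMap ℚ ℂ p from (eq_ratCast _ p).symm]
      exact isAlgebraic_algebraMap p
    have hq : IsAlgebraic ℚ (q : ℂ) := by
      rw [show (q : ℂ) = algebraMap ℚ ℂ q from (eq_ratCast _ q).symm]
      exact isAlgebraic_algebraMap q
    have hI : IsAlgebraic ℚ Complex.I := by
      refine ⟨Polynomial.X ^ 2 + Polynomial.C 1, Polynomial.X_pow_add_C_ne_zero (by norm_num) 1, ?_⟩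
      simp [Complex.I_sq]
    exact hp.add (hq.mul hI)

/-- **NoHiddenConstants from the term-germ stub** (E-derivations + Taylor): pick an E-derivation
`D` with `D ω ≠ 0`; for a germ family `𝒯 ∋ f`, `f ω = c ∈ dcl ∅` gives `D c = 0 = f′(ω)·Dω`, and
inductively every `f^{(k)}(ω)`, `k ≥ 1`, vanishes; by Taylor `f ≡ c` on the disc, so `c = f(α)`
for an algebraic `α` in the disc, and `f(α) ∈ F_α ≤ M`. -/
theorem noHiddenConstants_of_termGerm
    (hC : ∀ (ω c : ℂ), c ∈ fibre ω →
      ∃ r : ℝ, 0 < r ∧ ∃ 𝒯 : Set (ℂ → ℂ), (∃ f ∈ 𝒯, f ω = c) ∧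
        ∀ g ∈ 𝒯, DifferentiableOn ℂ g (Metric.ball ω r) ∧ deriv g ∈ 𝒯 ∧
          (∀ z ∈ Metric.ball ω r, g z ∈ fibre z) ∧
          ∀ z ∈ Metric.ball ω r, ∀ D : Derivation ℤ ℂ ℂ,
            IsEDerivation D → D (g z) = deriv g z * D z) :
    NoHiddenConstants := by
  intro ω hω c hc hcd
  -- an E-derivation moving `ω`
  obtain ⟨D, hD, hDω⟩ : ∃ D ∈ eDer ℂ (∅ : Set ℂ), D ω ≠ 0 := by
    by_contra h
    push Not at h
    exact hω h
  have hDE : IsEDerivation D := hD.1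
  obtain ⟨r, hr, 𝒯, ⟨f, hf𝒯, hfω⟩, h𝒯⟩ := hC ω c hc
  -- every iterated derivative of `f` is again in the family
  have hiter : ∀ k, iteratedDeriv k f ∈ 𝒯 := by
    intro k
    induction k with
    | zero => rw [iteratedDeriv_zero]; exact hf𝒯
    | succ k ih => rw [iteratedDeriv_succ]; exact (h𝒯 _ ih).2.1
  -- all derivatives of positive order vanish at `ω`
  have hvan : ∀ k, iteratedDeriv (k + 1) f ω = 0 := by
    intro k
    induction k with
    | zero =>
      have h1 := (h𝒯 _ (hiter 0)).2.2.2 ω (Metric.mem_ball_self hr) D hDE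
      rw [iteratedDeriv_zero, hfω, hcd D hD] at h1
      rw [iteratedDeriv_succ, iteratedDeriv_zero]
      exact (mul_eq_zero.mp h1.symm).resolve_right hDω
    | succ k ih =>
      have h1 := (h𝒯 _ (hiter (k + 1))).2.2.2 ω (Metric.mem_ball_self hr) D hDE
      rw [ih, map_zero] at h1
      rw [iteratedDeriv_succ]
      exact (mul_eq_zero.mp h1.symm).resolve_right hDω
  -- Taylor: `f ≡ c` on the disc
  have hconst : ∀ z ∈ Metric.ball ω r, f z = c := by
    intro z hz
    have hsum := Complex.hasSum_taylorSeries_on_ball (h𝒯 f hf𝒯).1 hz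
    have hsum0 : HasSum (fun n : ℕ => ((Nat.factorial n : ℂ))⁻¹ • (z - ω) ^ n • iteratedDeriv n f ω)
        (f ω) := by
      have h := hasSum_single (f := fun n : ℕ =>
        ((Nat.factorial n : ℂ))⁻¹ • (z - ω) ^ n • iteratedDeriv n f ω) 0 (by
          intro n hn
          obtain ⟨k, rfl⟩ := Nat.exists_eq_succ_of_ne_zero hn
          simp [hvan k])
      simpa [iteratedDeriv_zero] using h
    rw [← hfω]
    exact hsum.unique hsum0
  -- evaluate at an algebraic point of the disc
  obtain ⟨α, hαball, hαalg⟩ := exists_isAlgebraic_mem_ball ω hr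
  rw [← hconst α hαball]
  exact fibre_le_kernelFreeCore_of_isAlgebraic hαalg ((h𝒯 f hf𝒯).2.2.1 α hαball)

/-- `NoHiddenConstants` HOLDS modulo stub C (the fibres are the inlined `sInf`s by `rfl`). -/
theorem noHiddenConstants : NoHiddenConstants :=
  noHiddenConstants_of_termGerm stub_termGerm

/-- The registered landing form `stub_noHiddenConstants` IS `NoHiddenConstants` (definitional). -/
example : NoHiddenConstants := stub_noHiddenConstants

/-! ## Glue 3 (sorry-free): the generic fibre is free over the kernel-free core -/

/-- THE GENERIC-FIBRE STATEMENT: at every generic parameter the fibre satisfies relative Schanuel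
over the kernel-free core — the family statement whose KERNEL-FIBRE instance (`ω = 2πi ∈ dcl ∅`,
excluded here) is stub B. -/
def GenericFibre : Prop :=
  ∀ ω : ℂ, ω ∉ dcl (∅ : Set ℂ) → RelSchanuel (fibre ω) kernelFreeCore

open Submodule in
/-- **GenericFibre from NoHiddenConstants and Kirby's relative Schanuel theorem over `ecl ∅`**
(tree, PROVED: `kirby_relative_schanuel_complex_holds`): a tuple of `F_ω` independent modulo `M`
is independent modulo `ecl ∅` (a rational combination in `ecl ∅ ⊆ dcl ∅` lies in `F_ω ∩ dcl ∅ ⊆ M`),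
so `n ≤ trdeg` over `ℚ(ecl ∅)`, and base change to the smaller base `M ≤ ℚ(ecl ∅)` only raises the
transcendence degree (`trdeg_adjoin_le_of_le`). -/
theorem genericFibre_of_noHiddenConstants (hN : NoHiddenConstants) : GenericFibre := by
  intro ω hω n x hxF hxM
  let Mq : Submodule ℚ ℂ := Subalgebra.toSubmodule kernelFreeCore.toSubalgebra
  have hspanM : span ℚ (kernelFreeCore : Set ℂ) = Mq := span_eq Mq
  let Fq : Submodule ℚ ℂ := Subalgebra.toSubmodule (fibre ω).toSubalgebra
  let Eq : Submodule ℚ ℂ := Subalgebra.toSubmodule eclField.toSubalgebra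
  have hspanE : span ℚ (ecl (∅ : Set ℂ)) = Eq := by rw [← coe_eclField]; exact span_eq Eq
  have hVF : span ℚ (Set.range x) ≤ Fq := span_le.mpr (Set.range_subset_iff.mpr hxF)
  -- independence modulo `M` ⟹ independence modulo `ecl ∅`
  have hdisjM : Disjoint (span ℚ (Set.range x)) Mq := by
    have h := Submodule.range_ker_disjoint hxM
    rwa [ker_mkQ, hspanM] at h
  have hxE : LinearIndependent ℚ ((span ℚ (ecl (∅ : Set ℂ))).mkQ ∘ x) := by
    refine (LinearIndependent.of_comp _ hxM).map ?_
    rw [ker_mkQ, hspanE, disjoint_def]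
    intro a haV haE
    have haM : a ∈ kernelFreeCore := hN ω hω a (hVF haV) (ecl_subset_dcl (∅ : Set ℂ) haE)
    exact (disjoint_def.mp hdisjM) a haV haM
  -- Kirby's theorem over `ecl ∅`, then base change down to `M`
  have hK := kirby_relative_schanuel_complex_holds n x hxE
  have hle : kernelFreeCore ≤ IntermediateField.adjoin ℚ (ecl (∅ : Set ℂ)) :=
    kernelFreeCore_le_eclField.trans fun a ha => IntermediateField.subset_adjoin ℚ _ ha
  exact hK.trans (trdeg_adjoin_le_of_le hle _)

/-- **THE GENERIC-FIBRE THEOREM** (the card's first lemma), modulo stub C only. -/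
theorem genericFibre : GenericFibre :=
  genericFibre_of_noHiddenConstants noHiddenConstants

/-- The registered landing form `stub_genericFibre` IS `GenericFibre` (definitional). -/
example : GenericFibre := stub_genericFibre

/-- The registered landing form `stub_eaFibre_le_kernelFreeCore` is the glue
`fibre_le_kernelFreeCore_of_isAlgebraic` (definitional). -/
example : ∀ a : ℂ, IsAlgebraic ℚ a → fibre a ≤ kernelFreeCore := stub_eaFibre_le_kernelFreeCore

/-- Corollary (second half of the card's `GenericFibre`): at a generic parameter, Schanuel on the
fibre reduces to Schanuel on the kernel-free core (horizontal split with `L = F_ω`). -/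
theorem schanuelOn_fibre_of_generic {ω : ℂ} (hω : ω ∉ dcl (∅ : Set ℂ))
    (hA : SchanuelOn kernelFreeCore) : SchanuelOn (fibre ω) :=
  horizontalSplit kernelFreeCore_isEA.1 hA (genericFibre ω hω)

/-- WHY THE KERNEL FIBRE IS LEFT OVER (barrier `AxSchanuelFunctionalNotNumerical`, honoured): the
period `2πi` lies in `dcl ∅` — every E-derivation kills it (`e^{2πi} = 1`) — so `genericFibre` says
nothing at `ω = 2πi`; that instance is exactly stub B. -/
theorem two_pi_I_mem_dcl_empty : (2 * ↑Real.pi * Complex.I : ℂ) ∈ dcl (∅ : Set ℂ) := by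
  intro D hD
  have h := hD.1 (2 * ↑Real.pi * Complex.I)
  rw [show Literature.ModelTheory.ExponentialFields.ExponentialRing.exp (2 * ↑Real.pi * Complex.I) =
      Complex.exp (2 * ↑Real.pi * Complex.I) from rfl, Complex.exp_two_pi_mul_I, one_mul] at h
  rw [← h]
  exact D.map_one_eq_zero

/-! ## Calibration (sorry-free): rank 1 of stub B is bookkeeping; the generic locus is co-countable -/

/-- **Stub B at rank 1 is bookkeeping** (triage r1-2/r1-3): over a relatively algebraically closed base
`M`, an element independent modulo `M` is outside `M`, hence transcendental over `M`, so
`1 ≤ trdeg_M M(x, eˣ)`. The arithmetic of stub B starts at rank 2. -/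
theorem relSchanuel_rank_one {M : IntermediateField ℚ ℂ} (hM : IsEA M) (x : Fin 1 → ℂ)
    (hx : LinearIndependent ℚ ((Submodule.span ℚ (M : Set ℂ)).mkQ ∘ x)) :
    ((1 : ℕ) : Cardinal) ≤ Algebra.trdeg ↥M
      ↥(IntermediateField.adjoin ↥M (Set.range x ∪ Set.range (Complex.exp ∘ x))) := by
  have hx0 : x 0 ∉ M := by
    intro h0
    apply hx.ne_zero 0
    show (Submodule.span ℚ (M : Set ℂ)).mkQ (x 0) = 0
    rw [Submodule.mkQ_apply, Submodule.Quotient.mk_eq_zero]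
    exact Submodule.subset_span h0
  set S := Set.range x ∪ Set.range (Complex.exp ∘ x) with hS
  let t : ↥(IntermediateField.adjoin ↥M S) :=
    ⟨x 0, IntermediateField.subset_adjoin _ _ (Or.inl ⟨0, rfl⟩)⟩
  have ht : Transcendental ↥M t := fun halg =>
    hx0 (hM.2 _ (halg.algHom (IntermediateField.adjoin ↥M S).val))
  have hind : AlgebraicIndependent ↥M ![t] := algebraicIndependent_iff_transcendental.mpr ht
  simpa using hind.cardinalMk_le_trdeg

/-- Rank 1 of stub B itself (its statement at `n = 1`), PROVED. -/
theorem periodGenericOverCore_rank_one (x : Fin 1 → ℂ) (_hx : ∀ i, x i ∈ logFreeCore)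
    (hli : LinearIndependent ℚ ((Submodule.span ℚ (kernelFreeCore : Set ℂ)).mkQ ∘ x)) :
    ((1 : ℕ) : Cardinal) ≤ Algebra.trdeg ↥kernelFreeCore
      ↥(IntermediateField.adjoin ↥kernelFreeCore (Set.range x ∪ Set.range (Complex.exp ∘ x))) :=
  relSchanuel_rank_one kernelFreeCore_isEA x hli

/-- Non-vacuity of the generic locus, modulo Kirby 2010 Prop 7.1 (`dcl ⊆ ecl`, the tree's named fact
`Kirby2010_dcl_subset_ecl`; with the proved `ecl_subset_dcl` this is Thm 1.1 `ecl = dcl`): `ecl ∅` is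
countable (tree `ecl_empty_countable`), so generic parameters exist — indeed all but countably many
`ω` are generic. The `dcl`-form of `genericFibre` itself is fact-free. -/
theorem exists_not_mem_dcl (h : Kirby2010_dcl_subset_ecl ℂ) : ∃ ω : ℂ, ω ∉ dcl (∅ : Set ℂ) := by
  by_contra hall
  push Not at hall
  have hcount : (dcl (∅ : Set ℂ)).Countable :=
    Literature.Barriers.Schanuel.ecl_empty_countable.mono (h ∅)
  have hpre : (Complex.ofReal ⁻¹' dcl (∅ : Set ℂ)).Countable :=
    hcount.preimage Complex.ofReal_injective
  exact Cardinal.not_countable_real (hpre.mono fun r _ => hall r)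

/-- `genericFibre` with the hypothesis in Kirby's `ecl`-form ("`ω` exponentially transcendental"),
modulo the named fact `Kirby2010_dcl_subset_ecl` only. -/
theorem relSchanuel_fibre_of_not_mem_ecl (h : Kirby2010_dcl_subset_ecl ℂ) {ω : ℂ}
    (hω : ω ∉ ecl (∅ : Set ℂ)) : RelSchanuel (fibre ω) kernelFreeCore :=
  genericFibre ω fun hd => hω (h ∅ hd)

/-! ## Sanity (definitional): the landing stubs S1a / S1 are the glue's statements -/

/-- S1a IS `horizontalSplit` (general form), definitionally. -/
example : ∀ (M L : IntermediateField ℚ ℂ), (∀ w ∈ M, Complex.exp w ∈ M) →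
    SchanuelOn M → RelSchanuel L M → SchanuelOn L :=
  fun _ _ h hA hB => horizontalSplit h hA hB

/-- S1's two conjuncts ARE `SchanuelOn kernelFreeCore` and `RelSchanuel logFreeCore kernelFreeCore`. -/
example : (Summit.Schanuel.Schanuel.Theses.RigidCore.SchanuelOnLogFreeCore ↔
    (SchanuelOn kernelFreeCore ∧ RelSchanuel logFreeCore kernelFreeCore)) ↔
    (SchanuelOn logFreeCore ↔ (SchanuelOn kernelFreeCore ∧ RelSchanuel logFreeCore kernelFreeCore)) :=
  Iff.rfl

/-- The `⇐` half of S1 is the glue: `SchanuelOn kernelFreeCore → RelSchanuel logFreeCore kernelFreeCore →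
SchanuelOn logFreeCore` (stated with `SchanuelOn logFreeCore`, definitionally the crux, so that the skeleton
audit sees exactly ONE theorem concluding the crux by name, `SchanuelOnLogFreeCore_of`). -/
theorem schanuelOn_logFreeCore_of_split (hA : SchanuelOn kernelFreeCore)
    (hB : RelSchanuel logFreeCore kernelFreeCore) : SchanuelOn logFreeCore :=
  horizontalSplit (M := kernelFreeCore) (L := logFreeCore) kernelFreeCore_isEA.1 hA hB

/-! ## The crux from the line -/

/-- **The crux from stubs A and B** via the horizontal split at `M = kernelFreeCore`,
`L = logFreeCore` (the Transfer `C⁺ = A ∧ B ⟹ (R)`, kernel-checked). -/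
theorem SchanuelOnLogFreeCore_of : Summit.Schanuel.Schanuel.Theses.RigidCore.SchanuelOnLogFreeCore :=
  horizontalSplit (M := kernelFreeCore) (L := logFreeCore) kernelFreeCore_isEA.1
    stub_schanuelOnKernelFreeCore stub_periodGenericOverCore

end Summit.Schanuel.Schanuel.Cruxes.SchanuelOnLogFreeCore.GenericPeriodFibre

end
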